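import Mathlib
import Literature.Topology.FourManifolds.PlanarAchiralWords
import Literature.Topology.FourManifolds.PlanarShadowWalk
import Literature.Topology.FourManifolds.PlanarShadowDouble
import Summits.SmoothPoincare4.SmoothPoincare4.Theorems.ConvexBisectionPlanarAcyclicBisectionRigidityStubK4Lift
import Summits.SmoothPoincare4.SmoothPoincare4.Theorems.ConvexBisectionPlanarAcyclicBisectionRigidityHelperReachMon
import HarnessLib

/-!
# Crux `ConvexBisection.PlanarAcyclicBisectionRigidity`, line Sketch (v3.0) — helper
# `helper_twistLift3`: the twist-level lift of the `F₂` lever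

Pure algebra on the definitions of `Literature/Topology/FourManifolds/PlanarAchiralWords.lean`
(signed planar words, the moves `Move` and the orbit `Reachable`, `blockForm`, `TwistEq`) and of
`PlanarShadowWalk.lean` (the `F₂` shadow: `IsPos`, `XYPairs`, `startState`, `IsDoubleState`, the
shadow moves `PlanarShadow.Move` / `PlanarShadow.Reachable`, the round sub-alphabet `IsXYGen`,
`shadowWord`), on top of the group of units of the on-the-nose monoid `ArcData n` of
`…HelperReachMon` (`ReachMon.U n g`, the unit of a word; `ReachMon.T n ℓ`, the twist unit of a
signed letter; `T_false`, `T_not`, `T_hurwitzAct`) and the PROVED lever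
`PlanarShadow.reach_double_startState` (`PlanarShadowDouble.lean`).

* THE SHADOW HOM over the units of `…HelperReachMon`: `Φ : F₂ →* (ArcData 3)ˣ`, `x ↦ T_[0,1]`,
  `y ↦ T_[1,2]` (a `local notation`, no definition), and `U 3 g = Φ (shadowWord g)` for every word
  `g` in the round sub-alphabet (`TwistLift3.U_xy`).
* THE TWIST INVARIANT of a lifted state `(+d_A) · L · (−d_B)` against a shadow state `s`:
  letterwise `T ℓ = Φ g` and `(ℓ positive ↔ g positive)`, as a `List.Forall₂`, plus planar
  reachability.  A shadow Hurwitz move (or its inverse) at an inner position is realised by the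
  planar signed Hurwitz move (or its inverse) at the same position (`TwistLift3.step`): twists
  follow from `T_hurwitzAct` (the twist of `T_x^{±}(y)` is `T_x T_y T_x⁻¹`) and the hom laws of
  `Φ`, signs from the conjugation invariance of `IsPos` (`TwistLift3.isPos_conj_iff`) — no
  injectivity of `Φ` and no syntactic condition on the carrying words is needed.  Induction over
  the shadow orbit (`TwistLift3.walk`, reversed steps oriented by `K4Lift.move_symm`).
* START / FINISH (`helper_twistLift3`): the block form `[d_A, a₁, a₂] · \overline{[d_B, b₁, b₂]}ʳᵉᵛ`
  whose essential letters have twists `Φ p₁, Φ p₂, Φ q₁, Φ q₂` satisfies the invariant against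
  `startState (p₁, p₂) (q₁, q₂) = [p₁, p₂, q₂⁻¹, q₁⁻¹]` (negative letters: `T_false`, `map_inv`;
  the inverse of a positive shadow letter is not positive, `TwistLift3.not_isPos_inv`, by the
  total exponent `K4Lift.ε`); at the honest double `[g₁, g₂, g₂⁻¹, g₁⁻¹]` delivered by the lever
  the signs read `[+, +, −, −]`, so the reached planar word IS a block form
  `[d_A, k₁, k₂] · \overline{[d_B, k₄, k₃]}ʳᵉᵛ`, twist-equal letterwise
  (`T (k₄, +) = (T (k₄, −))⁻¹ = (Φ g₁⁻¹)⁻¹ = Φ g₁ = T (k₁, +)`).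

Uses nothing unproved.
-/

noncomputable section

open Literature.Topology.FourManifolds Literature.Topology.FourManifolds.PlanarWords
open Literature.Topology.FourManifolds.PlanarShadow (F₂ gx gy IsPos XYPairs startState
  IsDoubleState shadowGen shadowWord IsXYGen)

-- the prescribed namespace `Summit.<S>.<P>.…` repeats `SmoothPoincare4` (S = P = SmoothPoincare4)
set_option linter.dupNamespace false

namespace Summit.SmoothPoincare4.SmoothPoincare4.Theorems.PlanarAcyclicBisectionRigidity.Sketch

/-- `Φ : F₂ →* (ArcData 3)ˣ`, `x ↦ T_[0,1]`, `y ↦ T_[1,2]`, over the units of `…HelperReachMon`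
(notation local to this file). [folklore] -/
local notation "Φ₃" => (FreeGroup.lift ![ReachMon.U 3 [PGen.round 0 1 false],
  ReachMon.U 3 [PGen.round 1 2 false]] : F₂ →* (ArcData 3)ˣ)

namespace TwistLift3

variable {n : ℕ}

/-! ## Shadow letters: positivity under conjugation and inversion -/

/-- Positivity of a shadow letter is a conjugacy invariant (both ways). [folklore] -/
theorem isPos_conj_iff (a b : F₂) : IsPos (a * b * a⁻¹) ↔ IsPos b := by
  refine ⟨fun h => ?_, fun h => h.conj a⟩
  have h' := h.conj a⁻¹
  rwa [show a⁻¹ * (a * b * a⁻¹) * a⁻¹⁻¹ = b by group] at h'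

/-- The inverse of a positive shadow letter is not positive (total exponent `-1 ≠ 1`). [folklore] -/
theorem not_isPos_inv {g : F₂} (h : IsPos g) : ¬ IsPos g⁻¹ := by
  have hpos : ∀ z, IsPos z → K4Lift.ε z = Multiplicative.ofAdd 1 := fun z ⟨e, he⟩ => by
    rcases he with rfl | rfl <;> simp [K4Lift.ε, gx, gy, FreeGroup.lift_apply_of]
  intro h'
  have h1 := hpos _ h'
  rw [map_inv, hpos _ h] at h1
  have h2 := congrArg Multiplicative.toAdd h1
  simp only [toAdd_inv, toAdd_ofAdd] at h2
  omega

/-! ## Twist units and the shadow hom -/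

/-- The underlying arc data of the twist unit of a signed letter (definitional). [folklore] -/
theorem T_val (c : PlanarCurve) (s : Bool) :
    ((ReachMon.T n (c, s) : (ArcData n)ˣ) : ArcData n) = evalWord n (c.twistWord s) := rfl

/-- A generator of the round sub-alphabet evaluates, as a unit, to `Φ` of its shadow. [folklore] -/
theorem U_single {q : PGen} (hq : IsXYGen q) : ReachMon.U 3 [q] = Φ₃ (shadowGen q) := by
  have h01 : ReachMon.U 3 [PGen.round 0 1 true] = (ReachMon.U 3 [PGen.round 0 1 false])⁻¹ :=
    ReachMon.U_invWord [PGen.round 0 1 false]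
  have h12 : ReachMon.U 3 [PGen.round 1 2 true] = (ReachMon.U 3 [PGen.round 1 2 false])⁻¹ :=
    ReachMon.U_invWord [PGen.round 1 2 false]
  obtain ⟨s, rfl | rfl⟩ := hq <;> cases s <;>
    simp [PlanarShadow.shadowGen, h01, h12, map_inv, gx, gy, FreeGroup.lift_apply_of]

/-- A word in the round sub-alphabet evaluates, as a unit, to `Φ` of its shadow. [folklore] -/
theorem U_xy {g : List PGen} (hg : ∀ q ∈ g, IsXYGen q) : ReachMon.U 3 g = Φ₃ (shadowWord g) := by
  induction g with
  | nil =>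
    rw [PlanarShadow.shadowWord_nil, map_one]
    exact Units.ext rfl
  | cons q g ih =>
    rw [show q :: g = [q] ++ g from rfl, ReachMon.U_append, PlanarShadow.shadowWord_append,
      map_mul, K4Lift.shadowWord_singleton, U_single (hg q (by simp)),
      ih fun p hp => hg p (by simp [hp])]

/-! ## The twist invariant and the lift of shadow moves -/

/-- Splitting a `Forall₂`-related list against `pre ++ a :: b :: post`. [folklore] -/
theorem forall₂_split {α β : Type*} {R : α → β → Prop} :
    ∀ (pre : List β) {a b : β} {post : List β} {L : List α},
      List.Forall₂ R L (pre ++ a :: b :: post) →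
      ∃ (preL : List α) (x y : α) (postL : List α), L = preL ++ x :: y :: postL ∧
        List.Forall₂ R preL pre ∧ R x a ∧ R y b ∧ List.Forall₂ R postL post
  | [], a, b, post, L, h => by
    obtain ⟨x, L₁, hx, h₁, rfl⟩ := List.forall₂_cons_right_iff.1 h
    obtain ⟨y, L₂, hy, h₂, rfl⟩ := List.forall₂_cons_right_iff.1 h₁
    exact ⟨[], x, y, L₂, rfl, List.Forall₂.nil, hx, hy, h₂⟩
  | p :: pre, a, b, post, L, h => by
    obtain ⟨z, L₁, hz, h₁, rfl⟩ := List.forall₂_cons_right_iff.1 h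
    obtain ⟨preL, x, y, postL, rfl, hpre, hx, hy, hpost⟩ := forall₂_split pre h₁
    exact ⟨z :: preL, x, y, postL, rfl, List.Forall₂.cons hz hpre, hx, hy, hpost⟩

/-- THE STEP: a shadow move between shadow states is realised, on any lifted state
`D · L · E` satisfying the twist invariant (letterwise `T ℓ = Φ g` and `ℓ⁺ ↔ g` positive), by the
planar signed Hurwitz move (or its inverse) at the same inner position; twists follow by
`T_hurwitzAct` and the hom laws, signs by conjugation invariance of `IsPos`. [folklore] -/
theorem step {Φ : F₂ →* (ArcData n)ˣ} {S₀ : ℕ × List Letter} {D E : Letter} {L : List Letter}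
    {s t : List F₂} (hm : PlanarShadow.Move s t)
    (hL : List.Forall₂ (fun (ℓ : Letter) (g : F₂) => ReachMon.T n ℓ = Φ g ∧ (ℓ.2 = true ↔ IsPos g)) L s)
    (hr : Reachable S₀ (n, D :: (L ++ [E]))) :
    ∃ L' : List Letter,
      List.Forall₂ (fun (ℓ : Letter) (g : F₂) => ReachMon.T n ℓ = Φ g ∧ (ℓ.2 = true ↔ IsPos g)) L' t ∧
        Reachable S₀ (n, D :: (L' ++ [E])) := by
  have e : ∀ (preL postL : List Letter) (u v : Letter),
      (n, D :: (preL ++ u :: v :: postL ++ [E])) = (n, (D :: preL) ++ u :: v :: (postL ++ [E])) :=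
    fun _ _ _ _ => by simp
  cases hm with
  | hurwitz pre post a b =>
    obtain ⟨preL, x, y, postL, rfl, hpre, ⟨hxT, hxs⟩, ⟨hyT, hys⟩, hpost⟩ := forall₂_split pre hL
    refine ⟨preL ++ hurwitzAct x y :: x :: postL,
      List.rel_append hpre (List.Forall₂.cons ⟨?_, ?_⟩ (List.Forall₂.cons ⟨hxT, hxs⟩ hpost)), ?_⟩
    · rw [ReachMon.T_hurwitzAct, hxT, hyT, map_mul, map_mul, map_inv]
    · exact hys.trans (isPos_conj_iff a b).symm
    · rw [e] at hr
      rw [e]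
      exact Relation.ReflTransGen.tail hr (Or.inl (Move.hurwitz n _ _ x y))
  | hurwitzInv pre post a b =>
    obtain ⟨preL, x, y, postL, rfl, hpre, ⟨hxT, hxs⟩, ⟨hyT, hys⟩, hpost⟩ := forall₂_split pre hL
    refine ⟨preL ++ y :: hurwitzAct (y.1, !y.2) x :: postL,
      List.rel_append hpre (List.Forall₂.cons ⟨hyT, hys⟩ (List.Forall₂.cons ⟨?_, ?_⟩ hpost)), ?_⟩
    · rw [ReachMon.T_hurwitzAct, ReachMon.T_not, Prod.mk.eta, hxT, hyT, map_mul, map_mul, map_inv,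
        inv_inv]
    · exact hxs.trans (by simpa using (isPos_conj_iff b⁻¹ a).symm)
    · rw [e] at hr
      rw [e]
      exact Relation.ReflTransGen.tail hr (Or.inl (Move.hurwitzInv n _ _ x y))

/-- THE LIFT OF A SHADOW WALK at the twist level, move by move (always forward in
`PlanarWords`; reversed shadow steps are re-oriented by `K4Lift.move_symm`). [folklore] -/
theorem walk {Φ : F₂ →* (ArcData n)ˣ} {S₀ : ℕ × List Letter} {D E : Letter} {s t : List F₂}
    (h : PlanarShadow.Reachable s t)
    (hs : ∃ L : List Letter,
      List.Forall₂ (fun (ℓ : Letter) (g : F₂) => ReachMon.T n ℓ = Φ g ∧ (ℓ.2 = true ↔ IsPos g)) L s ∧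
        Reachable S₀ (n, D :: (L ++ [E]))) :
    ∃ L : List Letter,
      List.Forall₂ (fun (ℓ : Letter) (g : F₂) => ReachMon.T n ℓ = Φ g ∧ (ℓ.2 = true ↔ IsPos g)) L t ∧
        Reachable S₀ (n, D :: (L ++ [E])) := by
  induction h with
  | refl => exact hs
  | tail _ hm ih =>
    obtain ⟨L, hL, hr⟩ := ih
    exact step (hm.elim id K4Lift.move_symm) hL hr

end TwistLift3

/-- **Helper `helper_twistLift3` of line Sketch (v3.0) — THE TWIST-LEVEL LIFT of the `F₂` lever.**
For a level-`3` block form `[d_A, a₁, a₂] · \overline{[d_B, b₁, b₂]}ʳᵉᵛ` whose central letters have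
equal twists and whose essential letters have the twists of round sub-alphabet words with shadows
`p₁, p₂, q₁, q₂`, `(p₁, p₂), (q₁, q₂) ∈ XYPairs w`: the shadow walk from
`startState (p₁, p₂) (q₁, q₂)` to an honest double (the PROVED lever
`PlanarShadow.reach_double_startState`) lifts move by move to a planar walk at level `3`
(`TwistLift3.walk`: twists follow the shadow Hurwitz rule by `ReachMon.T_hurwitzAct`, signs by
conjugation invariance of positivity), ending at a block form `[d_A, k₁, k₂] · \overline{[d_B, k₄, k₃]}ʳᵉᵛ`
with `TwistEq 3 [d_A, k₁, k₂] [d_B, k₄, k₃]`. [folklore] -/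
theorem helper_twistLift3 (dA dB a₁ a₂ b₁ b₂ : PlanarCurve) (w p₁ p₂ q₁ q₂ : F₂) (hd : evalWord 3 (dA.twistWord true) = evalWord 3 (dB.twistWord true)) (hP : (p₁, p₂) ∈ XYPairs w) (hQ : (q₁, q₂) ∈ XYPairs w) (ha₁ : ∃ g : List PGen, (∀ q ∈ g, IsXYGen q) ∧ shadowWord g = p₁ ∧ evalWord 3 (a₁.twistWord true) = evalWord 3 g) (ha₂ : ∃ g : List PGen, (∀ q ∈ g, IsXYGen q) ∧ shadowWord g = p₂ ∧ evalWord 3 (a₂.twistWord true) = evalWord 3 g) (hb₁ : ∃ g : List PGen, (∀ q ∈ g, IsXYGen q) ∧ shadowWord g = q₁ ∧ evalWord 3 (b₁.twistWord true) = evalWord 3 g) (hb₂ : ∃ g : List PGen, (∀ q ∈ g, IsXYGen q) ∧ shadowWord g = q₂ ∧ evalWord 3 (b₂.twistWord true) = evalWord 3 g) : ∃ A' B' : List PlanarCurve, Reachable (3, blockForm [dA, a₁, a₂] [dB, b₁, b₂]) (3, blockForm A' B') ∧ TwistEq 3 A' B' := by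
  -- the twists of the four essential letters are `Φ` of their shadows
  have hT : ∀ {c : PlanarCurve} {p : F₂}, (∃ g : List PGen, (∀ q ∈ g, IsXYGen q) ∧ shadowWord g = p ∧
      evalWord 3 (c.twistWord true) = evalWord 3 g) → ReachMon.T 3 (c, true) = Φ₃ p := by
    rintro c p ⟨g, hg, rfl, he⟩
    exact Units.ext (he.trans (congrArg Units.val (TwistLift3.U_xy hg)))
  have h1 := hT ha₁
  have h2 := hT ha₂
  have h3 := hT hb₁
  have h4 := hT hb₂
  -- the signs of the shadows of the start state
  have hP' := hP
  have hQ' := hQ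
  obtain ⟨⟨c₁, hc₁⟩, ⟨c₂, hc₂⟩, -⟩ := hP'
  obtain ⟨⟨c₃, hc₃⟩, ⟨c₄, hc₄⟩, -⟩ := hQ'
  have pos₁ : IsPos p₁ := ⟨c₁, Or.inl hc₁⟩
  have pos₂ : IsPos p₂ := ⟨c₂, Or.inr hc₂⟩
  have pos₃ : IsPos q₁ := ⟨c₃, Or.inl hc₃⟩
  have pos₄ : IsPos q₂ := ⟨c₄, Or.inr hc₄⟩
  have neg₃ : ¬ IsPos q₁⁻¹ := TwistLift3.not_isPos_inv pos₃
  have neg₄ : ¬ IsPos q₂⁻¹ := TwistLift3.not_isPos_inv pos₄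
  have t₃ : ReachMon.T 3 (b₁, false) = Φ₃ q₁⁻¹ := by rw [ReachMon.T_false, h3, map_inv]
  have t₄ : ReachMon.T 3 (b₂, false) = Φ₃ q₂⁻¹ := by rw [ReachMon.T_false, h4, map_inv]
  -- START: the block form satisfies the twist invariant against the start state
  have hstart : List.Forall₂
      (fun (ℓ : Letter) (g : F₂) => ReachMon.T 3 ℓ = Φ₃ g ∧ (ℓ.2 = true ↔ IsPos g))
      [(a₁, true), (a₂, true), (b₂, false), (b₁, false)] [p₁, p₂, q₂⁻¹, q₁⁻¹] :=
    List.Forall₂.cons ⟨h1, by simpa using pos₁⟩ (List.Forall₂.cons ⟨h2, by simpa using pos₂⟩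
      (List.Forall₂.cons ⟨t₄, by simpa using neg₄⟩
        (List.Forall₂.cons ⟨t₃, by simpa using neg₃⟩ List.Forall₂.nil)))
  have e0 : ((dA, true) :: ([(a₁, true), (a₂, true), (b₂, false), (b₁, false)] ++ [(dB, false)]) :
      List Letter) = blockForm [dA, a₁, a₂] [dB, b₁, b₂] := rfl
  -- THE LEVER and THE LIFT
  obtain ⟨t, ht, g₁, g₂, hg₁, hg₂, rfl⟩ :=
    PlanarShadow.reach_double_startState w (p₁, p₂) (q₁, q₂) hP hQ
  obtain ⟨L, hL, hr⟩ := TwistLift3.walk (S₀ := (3, blockForm [dA, a₁, a₂] [dB, b₁, b₂]))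
    (D := (dA, true)) (E := (dB, false)) ht ⟨_, hstart, by rw [e0]; exact Reachable.refl _⟩
  -- FINISH: read the four letters and their signs off the honest double
  obtain ⟨⟨k₁, s₁⟩, L₁, ⟨h1T, h1s⟩, hL₁, rfl⟩ := List.forall₂_cons_right_iff.1 hL
  obtain ⟨⟨k₂, s₂⟩, L₂, ⟨h2T, h2s⟩, hL₂, rfl⟩ := List.forall₂_cons_right_iff.1 hL₁
  obtain ⟨⟨k₃, s₃⟩, L₃, ⟨h3T, h3s⟩, hL₃, rfl⟩ := List.forall₂_cons_right_iff.1 hL₂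
  obtain ⟨⟨k₄, s₄⟩, L₄, ⟨h4T, h4s⟩, hL₄, rfl⟩ := List.forall₂_cons_right_iff.1 hL₃
  obtain rfl : L₄ = [] := List.forall₂_nil_right_iff.1 hL₄
  obtain rfl : s₁ = true := h1s.2 hg₁
  obtain rfl : s₂ = true := h2s.2 hg₂
  obtain rfl : s₃ = false := by
    cases s₃
    · rfl
    · exact absurd (h3s.1 rfl) (TwistLift3.not_isPos_inv hg₂)
  obtain rfl : s₄ = false := by
    cases s₄
    · rfl
    · exact absurd (h4s.1 rfl) (TwistLift3.not_isPos_inv hg₁)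
  -- the reached word is a block form, twist-equal letterwise
  have eL : ((dA, true) :: ([(k₁, true), (k₂, true), (k₃, false), (k₄, false)] ++ [(dB, false)]) :
      List Letter) = blockForm [dA, k₁, k₂] [dB, k₄, k₃] := rfl
  rw [eL] at hr
  have e₁ : ReachMon.T 3 (k₁, true) = ReachMon.T 3 (k₄, true) := by
    rw [h1T, ← inv_inj, ← ReachMon.T_false, h4T, map_inv]
  have e₂ : ReachMon.T 3 (k₂, true) = ReachMon.T 3 (k₃, true) := by
    rw [h2T, ← inv_inj, ← ReachMon.T_false, h3T, map_inv]
  have e₁' : evalWord 3 (k₁.twistWord true) = evalWord 3 (k₄.twistWord true) := by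
    rw [← TwistLift3.T_val, ← TwistLift3.T_val, e₁]
  have e₂' : evalWord 3 (k₂.twistWord true) = evalWord 3 (k₃.twistWord true) := by
    rw [← TwistLift3.T_val, ← TwistLift3.T_val, e₂]
  exact ⟨[dA, k₁, k₂], [dB, k₄, k₃], hr,
    List.Forall₂.cons hd (List.Forall₂.cons e₁' (List.Forall₂.cons e₂' List.Forall₂.nil))⟩

end Summit.SmoothPoincare4.SmoothPoincare4.Theorems.PlanarAcyclicBisectionRigidity.Sketch

end
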